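import Summits.BirchSwinnertonDyer.BirchSwinnertonDyer.Theorems.KimAtThreeShallowEqDeepGoodCoreVertexOrder
import Summits.BirchSwinnertonDyer.Rank1Residual.GaloisImage.KolyvaginPrimeTransverse
import Summits.BirchSwinnertonDyer.Rank1Residual.GaloisImage.TransverseLocalCriterion
import Summits.BirchSwinnertonDyer.Rank1Residual.GaloisImage.KolyvaginInjectivityAllDepths
import Summits.BirchSwinnertonDyer.Rank1Residual.GaloisImage.SakamotoN11InstanceResidual
import HarnessLib

/-!
# Route `KimAtThreeKolyvagin` (rung W2), crux `ShallowEqDeepAtTorsionFree` (stmt-BirchSwinnertonDyer-19077):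
# the transverse condition is ONTO along `[3^k] : E[3^k·3] → E[3]` at a deep Kolyvagin prime — the last
# local input of the GOOD CORE VERTEX port — and `hord` on the deep class modulo [S24]

Cell `bsd-addord`, seat `bsd-addord-w2-c4` (D-0074 row B7), gen 3; sixth file of the port (siblings
`KimAtThreeShallowEqDeepGoodCoreVertex{,Rat,Devissage,Core,Order}`).  TOOL theorems only (no definition,
no named fact, no `sorry`); nothing asserted about any curve; nothing booked; no crux proved.
* `transverseSubgroup_le_map_of_invariant` (any local field `F ⊇ ℚ`, `χ̄_ℓ` onto on inertia):
  `𝒯(F, M₂) ≤ red_* 𝒯(F, M₁)` as soon as some `Γ_F`-invariant `m₁` has `red m₁ ≠ 0`, `(ℓ−1)M₁ = 0`,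
  inertia acts trivially on `M₂` and `#𝒯(F, M₂)` is prime — via the EXPLICIT transverse cocycle
  `g ↦ n(g)·m₁` (`χ̄_ℓ(g) = u^{n(g)}`, Rubin Prop. 1.9.5 (1): `H¹_tr ≅ Hom(Gal(F(μ_ℓ)/F), M^{Fr=1})`),
  non-zero after `red` on an inertia element with `χ̄_ℓ = u`; `cyclotomicTransverse_le_map_localMap_…`
  is its place-level form.
* `exists_invariant_torsionMulBy_ne_zero`, `cyclotomicTransverse_le_map_torsionMulBy_of_mem_frobeniusClassPrimes`:
  the hypotheses DISCHARGED at a prime of Sakamoto's class of `τ` on `E[3^{j+1}·3]` (invariant counts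
  `3^{j+2}`, `3^{j+1}` — n1011 `natCard_invariants_toLocal_of_mem_frobeniusClassPrimes` — give an
  invariant not killed by `[3^{j+1}]`; `(ℓ−1)M = 0`, unramified, `#𝒯 = 3` from n1011).
So file 5's `honto` holds on the deep class; the assembly (`λ^*(d) = 0` with no local hypothesis, and
EndCore's `hord` modulo [S24] Thm. 4.4 (1)) is the sibling `KimAtThreeShallowEqDeepGoodCoreVertexHord`.
References: [Rubin2011] Prop. 1.4.13, Prop. 1.9.5, Def. 2.5.3; [MazurRubin2004] Lemma 1.2.3, Thm. 4.4.1,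
Cor. 4.1.9; [Sakamoto2024] Thm. 4.4 (1), §6.
-/

set_option autoImplicit false
-- the Theorems namespace of a single-conjunct summit repeats the summit name by design (D-0017)
set_option linter.dupNamespace false

noncomputable section

open scoped Classical NumberField ContRepresentation Pointwise
open Function Field NumberField IsDedekindDomain
open Literature.NumberTheory.GaloisRepresentations Literature.NumberTheory.GaloisRepresentations.DiscreteGaloisModule
  Literature.NumberTheory.GaloisCohomology
open Summit.BirchSwinnertonDyer.Rank1Residual.GaloisImage
open Summit.BirchSwinnertonDyer.Rank1Residual.GaloisImage.CoreRankZero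
open Summit.BirchSwinnertonDyer.Rank1Residual.X11b.Levels

universe u

namespace Summit.BirchSwinnertonDyer.BirchSwinnertonDyer.Theorems.KimAtThreeShallowEqDeepGoodCoreVertex

section LocalOnto

variable {F : Type u} [Field F] [CharZero F] {M₁ M₂ : Type u}
  [AddCommGroup M₁] [TopologicalSpace M₁] [DiscreteTopology M₁]
  [AddCommGroup M₂] [TopologicalSpace M₂] [DiscreteTopology M₂]
  (ρ₁ : DiscreteGaloisModule F M₁) (ρ₂ : DiscreteGaloisModule F M₂)
  (ℓ : ℕ) [Fact ℓ.Prime] [NeZero (ℓ : F)]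

/-- A function on `Γ_F` factoring through `χ̄_ℓ` is continuous into a discrete space. [folklore] -/
theorem continuous_comp_modPCyclotomicCharacterZMod {X : Type*} [TopologicalSpace X]
    [DiscreteTopology X] (f : (ZMod ℓ)ˣ → X) :
    Continuous fun g : absoluteGaloisGroup F => f (modPCyclotomicCharacterZMod F ℓ g) := by
  set χ := modPCyclotomicCharacterZMod F ℓ
  have hker : IsOpen ((χ.ker : Subgroup (absoluteGaloisGroup F)) : Set (absoluteGaloisGroup F)) :=
    Summit.BirchSwinnertonDyer.Rank1Residual.GaloisImage.Derivative.Transverse.isOpen_ker_modPCyclotomicCharacterZMod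
      F ℓ
  have hfib : ∀ v : (ZMod ℓ)ˣ, IsOpen (χ ⁻¹' {v}) := by
    intro v
    have heq : χ ⁻¹' {v} = (χ ⁻¹' {v}) * (χ.ker : Set (absoluteGaloisGroup F)) := by
      ext x
      constructor
      · intro hx
        exact ⟨x, hx, 1, χ.ker.one_mem, mul_one x⟩
      · rintro ⟨y, hy, k, hk, rfl⟩
        rw [Set.mem_preimage, Set.mem_singleton_iff] at hy ⊢
        rw [map_mul, hy, (MonoidHom.mem_ker).1 hk, mul_one]
    rw [heq]
    exact hker.mul_left
  refine continuous_discrete_rng.2 fun b => ?_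
  have : (fun g : absoluteGaloisGroup F => f (χ g)) ⁻¹' {b} = ⋃ v ∈ f ⁻¹' {b}, χ ⁻¹' {v} := by
    ext g
    simp only [Set.mem_preimage, Set.mem_singleton_iff, Set.mem_iUnion, exists_prop]
    exact ⟨fun h => ⟨χ g, h, rfl⟩, fun ⟨v, hv, hgv⟩ => by rw [hgv]; exact hv⟩
  rw [this]
  exact isOpen_biUnion fun v _ => hfib v

/-- **The transverse condition is ONTO along `red : M₁ → M₂` at a tamely ramified prime**: if some
`Γ_F`-invariant `m₁ ∈ M₁` has `red m₁ ≠ 0`, `(ℓ − 1)·M₁ = 0`, the inertia group acts trivially on `M₂`,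
the mod-`ℓ` cyclotomic character is onto on inertia, and `#𝒯(F, M₂)` is prime, then
`𝒯(F, M₂) ≤ red_* 𝒯(F, M₁)` for the `F(μ_ℓ)`-transverse subgroups.  The explicit transverse class of
`m₁` is `g ↦ n(g)·m₁`, `χ̄_ℓ(g) = u^{n(g)}` for a generator `u` of `(ℤ/ℓ)ˣ` (Rubin Prop. 1.9.5 (1):
`H¹_tr ≅ Hom(Gal(F(μ_ℓ)/F), M^{Fr=1})`); its image `g ↦ n(g)·red m₁` is non-zero on an inertia element
with `χ̄_ℓ = u`, and a non-zero subgroup of a group of prime order is everything.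
[cite: Rubin2011, Prop. 1.9.5 (1) (p. 16) and Def. 1.9.4 (p. 14)] [cite: MazurRubin2004, Lemma 1.2.3] -/
theorem transverseSubgroup_le_map_of_invariant [ValuativeRel F] [TopologicalSpace F]
    [IsNonarchimedeanLocalField F]
    (red : ρ₁.toContRepresentation →ⁱL ρ₂.toContRepresentation)
    (m₁ : M₁) (hm₁ : ∀ g : absoluteGaloisGroup F, ρ₁ g m₁ = m₁) (hred : red m₁ ≠ 0)
    (hM₁ : ∀ m : M₁, (ℓ - 1) • m = 0)
    (hI₂ : ∀ t ∈ absInertia F, ∀ m : M₂, ρ₂ t m = m)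
    (hχI : ∀ v : (ZMod ℓ)ˣ, ∃ t ∈ absInertia F, modPCyclotomicCharacterZMod F ℓ t = v)
    {p : ℕ} (hp : p.Prime)
    (hcard : Nat.card (transverseSubgroup ρ₂ (CyclotomicField ℓ F)) = p) :
    transverseSubgroup ρ₂ (CyclotomicField ℓ F) ≤
      (transverseSubgroup ρ₁ (CyclotomicField ℓ F)).map (galoisCohomology.map red 1) := by
  set χ := modPCyclotomicCharacterZMod F ℓ with hχ
  -- a generator `u` of `(ℤ/ℓ)ˣ` and discrete logarithms `n : (ℤ/ℓ)ˣ → ℤ`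
  obtain ⟨u, hu⟩ := IsCyclic.exists_generator (α := (ZMod ℓ)ˣ)
  have hordu : orderOf u = ℓ - 1 := by
    rw [orderOf_eq_card_of_forall_mem_zpowers hu, Nat.card_eq_fintype_card, ZMod.card_units]
  have hn : ∀ v : (ZMod ℓ)ˣ, ∃ n : ℤ, u ^ n = v := fun v => Subgroup.mem_zpowers_iff.1 (hu v)
  choose n hnu using hn
  -- `(a - b) • m = 0` on `M₁` whenever `u ^ a = u ^ b`
  have hsmul₁ : ∀ (a b : ℤ) (m : M₁), u ^ a = u ^ b → a • m = b • m := by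
    intro a b m hab
    have hmod : a ≡ b [ZMOD orderOf u] := zpow_eq_zpow_iff_modEq.1 hab
    rw [hordu] at hmod
    obtain ⟨c, hc⟩ := (Int.modEq_iff_dvd.1 hmod.symm)
    have h0 : ((ℓ - 1 : ℕ) : ℤ) • m = 0 := by rw [natCast_zsmul]; exact hM₁ m
    have : a = b + ((ℓ - 1 : ℕ) : ℤ) * c := by linarith
    rw [this, add_zsmul, mul_comm, mul_zsmul, h0, zsmul_zero, add_zero]
  have hsmul₂ : ∀ (a b : ℤ) (m : M₂), (∃ m' : M₁, red m' = m) → u ^ a = u ^ b → a • m = b • m := by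
    rintro a b m ⟨m', rfl⟩ hab
    rw [← map_zsmul, ← map_zsmul, hsmul₁ a b m' hab]
  -- the explicit cocycles `φ₁ g = n(χ g) • m₁`, `φ₂ = red ∘ φ₁`
  have hadd : ∀ g h : absoluteGaloisGroup F, n (χ (g * h)) • m₁ = n (χ g) • m₁ + n (χ h) • m₁ := by
    intro g h
    rw [← add_zsmul]
    apply hsmul₁
    rw [hnu, zpow_add, hnu, hnu, map_mul]
  let φ₁ : contOneCocycles ρ₁.toTopRep :=
    ⟨⟨fun g => n (χ g) • m₁, continuous_comp_modPCyclotomicCharacterZMod ℓ (fun v => n v • m₁)⟩,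
      fun g h => by
        change n (χ (g * h)) • m₁ = n (χ g) • m₁ + ρ₁ g (n (χ h) • m₁)
        rw [map_zsmul, hm₁ g, hadd]⟩
  have hφ₁ : ∀ g, φ₁.1 g = n (χ g) • m₁ := fun g => rfl
  -- `[φ₁]` is transverse (it vanishes on `ker χ̄`)
  have hφ₁T : oneCocycleClass ρ₁.toTopRep φ₁ ∈ transverseSubgroup ρ₁ (CyclotomicField ℓ F) := by
    rw [mem_transverseSubgroup_cyclotomicField_iff]
    refine ⟨0, fun g hg => ?_⟩
    rw [hφ₁, map_zero, sub_zero]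
    have h := hsmul₁ (n (χ g)) 0 m₁ (by rw [hnu, hg, zpow_zero])
    rwa [zero_zsmul] at h
  -- its image is `[φ₂]`, `φ₂ g = n(χ g) • red m₁`, which is non-zero
  have hφ₂ne : galoisCohomology.map red 1 (oneCocycleClass ρ₁.toTopRep φ₁) ≠ 0 := by
    rw [galoisCohomology.map_one_oneCocycleClass]
    intro h0
    obtain ⟨y, hy⟩ := (oneCocycleClass_eq_zero_iff _ _).1 h0
    obtain ⟨t, ht, htu⟩ := hχI u
    have h1 := hy t
    change red (n (χ t) • m₁) = ρ₂ t y - y at h1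
    rw [hI₂ t ht, sub_self, map_zsmul, htu] at h1
    have h2 : n u • red m₁ = (1 : ℤ) • red m₁ :=
      hsmul₂ (n u) 1 (red m₁) ⟨m₁, rfl⟩ (by rw [hnu, zpow_one])
    rw [h2, one_zsmul] at h1
    exact hred h1
  -- a non-zero subgroup of the prime-order group `𝒯(M₂)` is everything
  have hle : (transverseSubgroup ρ₁ (CyclotomicField ℓ F)).map (galoisCohomology.map red 1) ≤
      transverseSubgroup ρ₂ (CyclotomicField ℓ F) := by
    rintro _ ⟨c, hc, rfl⟩
    exact KSDevissage.map_mem_transverseSubgroup red _ hc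
  have hne : (transverseSubgroup ρ₁ (CyclotomicField ℓ F)).map (galoisCohomology.map red 1) ≠ ⊥ := by
    intro h
    have hmem : galoisCohomology.map red 1 (oneCocycleClass ρ₁.toTopRep φ₁) ∈
        (transverseSubgroup ρ₁ (CyclotomicField ℓ F)).map (galoisCohomology.map red 1) :=
      ⟨_, hφ₁T, rfl⟩
    rw [h, AddSubgroup.mem_bot] at hmem
    exact hφ₂ne hmem
  exact (CoreRankOne.eq_of_le_of_natCard_eq_prime hp hle hcard hne).ge

end LocalOnto

section LocalOntoPlace

variable {K : Type} [Field K] [NumberField K] {M₁ M₂ : Type}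
  [AddCommGroup M₁] [TopologicalSpace M₁] [DiscreteTopology M₁]
  [AddCommGroup M₂] [TopologicalSpace M₂] [DiscreteTopology M₂]
  (ρ₁ : DiscreteGaloisModule K M₁) (ρ₂ : DiscreteGaloisModule K M₂)

/-- `transverseSubgroup_le_map_of_invariant` at a finite place `q` of a number field, for the LOCAL
modules `ρᵢ|_{Γ_{K_q}}` of global ones and the restriction of a global equivariant `red` (the shape
consumed by Selmer structures: `cyclotomicTransverse`, `localMap`). [cite: Rubin2011, Prop. 1.9.5 (1) (p. 16)] -/
theorem cyclotomicTransverse_le_map_localMap_of_invariant (q : HeightOneSpectrum (𝓞 K))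
    [Fact (Ideal.absNorm q.asIdeal).Prime]
    [NeZero ((Ideal.absNorm q.asIdeal : ℕ) : q.adicCompletion K)]
    (red : ρ₁.toContRepresentation →ⁱL ρ₂.toContRepresentation)
    (m₁ : M₁) (hm₁ : ∀ g : absoluteGaloisGroup (q.adicCompletion K), GaloisRep.toLocal q ρ₁ g m₁ = m₁)
    (hred : red m₁ ≠ 0) (hM₁ : ∀ m : M₁, (Ideal.absNorm q.asIdeal - 1) • m = 0)
    (hI₂ : ∀ t ∈ absInertia (q.adicCompletion K), ∀ m : M₂, GaloisRep.toLocal q ρ₂ t m = m)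
    (hχI : ∀ v : (ZMod (Ideal.absNorm q.asIdeal))ˣ, ∃ t ∈ absInertia (q.adicCompletion K),
      modPCyclotomicCharacterZMod (q.adicCompletion K) (Ideal.absNorm q.asIdeal) t = v)
    {p : ℕ} (hp : p.Prime) (hcard : Nat.card (cyclotomicTransverse ρ₂ (Sum.inr q)) = p) :
    cyclotomicTransverse ρ₂ (Sum.inr q) ≤ (cyclotomicTransverse ρ₁ (Sum.inr q)).map (localMap red (Sum.inr q)) := by
  haveI : CharZero (q.adicCompletion K) :=
    charZero_of_injective_algebraMap (algebraMap K (q.adicCompletion K)).injective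
  rw [cyclotomicTransverse_inr] at hcard ⊢
  rw [cyclotomicTransverse_inr]
  exact transverseSubgroup_le_map_of_invariant (GaloisRep.toLocal q ρ₁) (GaloisRep.toLocal q ρ₂)
    (Ideal.absNorm q.asIdeal) (red.restrictField (q.adicCompletion K)) m₁ hm₁ hred hM₁ hI₂ hχI hp hcard

end LocalOntoPlace

section Curve

open WeierstrassCurve Literature.NumberTheory.EllipticCurves

variable (W : WeierstrassCurve ℚ) [W.IsElliptic] (j : ℕ)

omit [W.IsElliptic] in
/-- **An invariant of `E[3^{j+1}·3]` at `q` not killed by `[3^{j+1}]`** when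
`#H⁰(ℚ_q, E[3^{j+1}·3]) = 3^{j+2}` and `#H⁰(ℚ_q, E[3^j·3]) = 3^{j+1}`: otherwise the invariants of
`E[3^{j+2}]` would inject into those of `E[3^{j+1}]`. [cite: Rubin2011, Prop. 1.4.13 (1) (p. 9)] -/
theorem exists_invariant_torsionMulBy_ne_zero (q : HeightOneSpectrum (𝓞 ℚ))
    (hN : Nat.card (GaloisRep.toLocal q
      (W.torsionGaloisModule (((3 : ℕ) : ℤ) ^ (j + 1) * ((3 : ℕ) : ℤ)))).toTopRep.ρ.invariants = 3 ^ (j + 2))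
    (hd : Nat.card (GaloisRep.toLocal q
      (W.torsionGaloisModule (((3 : ℕ) : ℤ) ^ j * ((3 : ℕ) : ℤ)))).toTopRep.ρ.invariants = 3 ^ (j + 1)) :
    ∃ m : geomTorsion W (((3 : ℕ) : ℤ) ^ (j + 1) * ((3 : ℕ) : ℤ)),
      (∀ g : absoluteGaloisGroup (q.adicCompletion ℚ),
        GaloisRep.toLocal q (W.torsionGaloisModule (((3 : ℕ) : ℤ) ^ (j + 1) * ((3 : ℕ) : ℤ))) g m = m) ∧
      W.torsionMulBy (((3 : ℕ) : ℤ) ^ (j + 1)) ((3 : ℕ) : ℤ) m ≠ 0 := by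
  set ρN := GaloisRep.toLocal q (W.torsionGaloisModule (((3 : ℕ) : ℤ) ^ (j + 1) * ((3 : ℕ) : ℤ)))
    with hρN
  set ρd := GaloisRep.toLocal q (W.torsionGaloisModule (((3 : ℕ) : ℤ) ^ j * ((3 : ℕ) : ℤ))) with hρd
  set L := q.adicCompletion ℚ with hL
  by_contra hall
  push Not at hall
  -- every invariant is killed by `3^{j+1}`, hence lies in `E[3^j·3]`
  have hmem : ∀ w : ρN.toTopRep.ρ.invariants,
      ((w.1 : geomTorsion W _) : geomPoints W) ∈ geomTorsion W (((3 : ℕ) : ℤ) ^ j * ((3 : ℕ) : ℤ)) := by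
    intro w
    have h0 := hall w.1 (fun g => w.2 g)
    have h1 : (((3 : ℕ) : ℤ) ^ (j + 1)) • ((w.1 : geomTorsion W _) : geomPoints W) = 0 := by
      have h := congrArg (fun P : geomTorsion W ((3 : ℕ) : ℤ) => (P : geomPoints W)) h0
      dsimp only at h
      rwa [coe_torsionMulBy_apply, ZeroMemClass.coe_zero] at h
    rw [mem_geomTorsion_iff, ← pow_succ]
    exact h1
  -- the action on invariants, read on points
  have hinv : ∀ (w : ρN.toTopRep.ρ.invariants) (g : absoluteGaloisGroup L),
      absGaloisRestrict ℚ L g • ((w.1 : geomTorsion W _) : geomPoints W) = (w.1 : geomTorsion W _) := by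
    intro w g
    have h := congrArg (fun P : geomTorsion W (((3 : ℕ) : ℤ) ^ (j + 1) * ((3 : ℕ) : ℤ)) =>
      (P : geomPoints W)) (w.2 g)
    change (((W.torsionGaloisModule (((3 : ℕ) : ℤ) ^ (j + 1) * ((3 : ℕ) : ℤ)))
      (absGaloisRestrict ℚ L g) w.1 : geomTorsion W _) : geomPoints W) = _ at h
    rwa [torsionGaloisModule_apply_apply,
      Literature.NumberTheory.EllipticCurves.AddSubgroup.torsionBy.coe_smul] at h
  have hfix : ∀ (w : ρN.toTopRep.ρ.invariants) (g : absoluteGaloisGroup L),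
      ρd.toTopRep.ρ g ⟨((w.1 : geomTorsion W _) : geomPoints W), hmem w⟩ =
        ⟨((w.1 : geomTorsion W _) : geomPoints W), hmem w⟩ := by
    intro w g
    apply Subtype.ext
    change (((W.torsionGaloisModule (((3 : ℕ) : ℤ) ^ j * ((3 : ℕ) : ℤ))) (absGaloisRestrict ℚ L g)
      ⟨((w.1 : geomTorsion W _) : geomPoints W), hmem w⟩ : geomTorsion W _) : geomPoints W) = _
    rw [torsionGaloisModule_apply_apply, Literature.NumberTheory.EllipticCurves.AddSubgroup.torsionBy.coe_smul]
    exact hinv w g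
  let ι : ρN.toTopRep.ρ.invariants → ρd.toTopRep.ρ.invariants := fun w =>
    ⟨⟨((w.1 : geomTorsion W _) : geomPoints W), hmem w⟩, hfix w⟩
  have hι : Function.Injective ι := by
    intro w w' h
    have h' : ((w.1 : geomTorsion W _) : geomPoints W) = ((w'.1 : geomTorsion W _) : geomPoints W) :=
      congrArg (fun P : ρd.toTopRep.ρ.invariants => ((P.1 : geomTorsion W _) : geomPoints W)) h
    exact Subtype.ext (Subtype.ext h')
  haveI : Finite ρd.toTopRep.ρ.invariants :=
    Nat.finite_of_card_ne_zero (by rw [hd]; exact pow_ne_zero _ three_ne_zero)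
  have hle := Nat.card_le_card_of_injective ι hι
  rw [hN, hd] at hle
  have : 3 ^ (j + 1) < 3 ^ (j + 2) := Nat.pow_lt_pow_right (by norm_num) (by omega)
  omega

/-- **The local ONTO statement `honto` of `lambdaStar_induced_atLevel_eq_zero_of_transverse_onto` at a
Kolyvagin prime of the DEEP class** (`q ∈ frobeniusClassPrimes (E[3^{j+1}·3]) S τ 3^{j+2}`, `τ` with the
(H.2) shapes at the levels `j + 2`, `j + 1`, `1`): `𝒯(ℚ_q, E[3]) ≤ [3^{j+1}]_* 𝒯(ℚ_q, E[3^{j+1}·3])`.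
Inputs (n1011): the invariant counts `natCard_invariants_toLocal_of_mem_frobeniusClassPrimes`, `(ℓ − 1)·M = 0`
(`absNorm_sub_one_smul_eq_zero_…`), `E[3]` unramified at `q`, `χ̄_ℓ` onto on inertia
(`modPCyclotomicCharacter_surjOn_absInertia_rat_holds`), `#𝒯(ℚ_q, E[3]) = 3`.
[cite: Rubin2011, Prop. 1.9.5 (1) (p. 16)] [cite: MazurRubin2004, Lemma 1.2.3] -/
theorem cyclotomicTransverse_le_map_torsionMulBy_of_mem_frobeniusClassPrimes
    [Finite (geomTorsion W ((3 : ℕ) : ℤ))] {Sset : Set (HeightOneSpectrum (𝓞 ℚ))} {τ : absoluteGaloisGroup ℚ}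
    (hτμ : τ ∈ rootsOfUnityFixer ℚ (3 ^ (j + 1 + 1)))
    (hτ₂ : Nonempty (cokerSubOne (W.torsionGaloisModule (((3 : ℕ) : ℤ) ^ (j + 1) * ((3 : ℕ) : ℤ))) τ ≃+
      ZMod (3 ^ (j + 1 + 1))))
    (hτ₃ : Nonempty (cokerSubOne (W.torsionGaloisModule (((3 : ℕ) : ℤ) ^ j * ((3 : ℕ) : ℤ))) τ ≃+
      ZMod (3 ^ (j + 1))))
    (hτ₁ : Nonempty (cokerSubOne (W.torsionGaloisModule ((3 : ℕ) : ℤ)) τ ≃+ ZMod 3))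
    {q : HeightOneSpectrum (𝓞 ℚ)}
    (hq : q ∈ frobeniusClassPrimes (W.torsionGaloisModule (((3 : ℕ) : ℤ) ^ (j + 1) * ((3 : ℕ) : ℤ)))
      Sset τ (3 ^ (j + 1 + 1))) :
    cyclotomicTransverse (W.torsionGaloisModule ((3 : ℕ) : ℤ)) (Sum.inr q) ≤
      (cyclotomicTransverse (W.torsionGaloisModule (((3 : ℕ) : ℤ) ^ (j + 1) * ((3 : ℕ) : ℤ))) (Sum.inr q)).map
        (localMap (W.torsionMulBy (((3 : ℕ) : ℤ) ^ (j + 1)) ((3 : ℕ) : ℤ)) (Sum.inr q)) := by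
  haveI : Fact (Nat.Prime 3) := ⟨Nat.prime_three⟩
  haveI : Finite (geomTorsion W (((3 : ℕ) : ℤ) ^ (j + 1) * ((3 : ℕ) : ℤ))) :=
    finite_geomTorsion_pow_mul W 3 (j + 1)
  haveI : Finite (geomTorsion W (((3 : ℕ) : ℤ) ^ j * ((3 : ℕ) : ℤ))) := finite_geomTorsion_pow_mul W 3 j
  haveI : CharZero (q.adicCompletion ℚ) :=
    charZero_of_injective_algebraMap (algebraMap ℚ (q.adicCompletion ℚ)).injective
  haveI hprime : Fact (Ideal.absNorm q.asIdeal).Prime := ⟨FSComp.prime_absNorm_rat q⟩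
  haveI : NeZero ((Ideal.absNorm q.asIdeal : ℕ) : q.adicCompletion ℚ) :=
    ⟨Nat.cast_ne_zero.2 (FSComp.prime_absNorm_rat q).ne_zero⟩
  -- sub-classes
  have hdvd₂₃ : 3 ^ (j + 1) ∣ 3 ^ (j + 1 + 1) := pow_dvd_pow 3 (Nat.le_succ _)
  have hdvd₂₁ : 3 ∣ 3 ^ (j + 1 + 1) := dvd_pow_self 3 (Nat.succ_ne_zero _)
  have hker₃ : ∀ u : absoluteGaloisGroup ℚ,
      (W.torsionGaloisModule (((3 : ℕ) : ℤ) ^ (j + 1) * ((3 : ℕ) : ℤ))) u = 1 →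
        (W.torsionGaloisModule (((3 : ℕ) : ℤ) ^ j * ((3 : ℕ) : ℤ))) u = 1 := fun u hu =>
    S24Deep.torsionGaloisModule_eq_one_of_dvd W (Transport.pow_mul_dvd_pow_mul (Nat.le_succ j)) u hu
  have hker₁ : ∀ u : absoluteGaloisGroup ℚ,
      (W.torsionGaloisModule (((3 : ℕ) : ℤ) ^ (j + 1) * ((3 : ℕ) : ℤ))) u = 1 →
        (W.torsionGaloisModule ((3 : ℕ) : ℤ)) u = 1 := fun u hu =>
    S24Deep.torsionGaloisModule_eq_one_of_dvd W (TorsionLevel.three_dvd_pow_succ_mul j) u hu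
  have hq₃ : q ∈ frobeniusClassPrimes (W.torsionGaloisModule (((3 : ℕ) : ℤ) ^ j * ((3 : ℕ) : ℤ)))
      Sset τ (3 ^ (j + 1)) :=
    S24Deep.frobeniusClassPrimes_mono _ _ hker₃ Sset τ hdvd₂₃ hq
  have hq₁ : q ∈ frobeniusClassPrimes (W.torsionGaloisModule ((3 : ℕ) : ℤ)) Sset τ 3 :=
    S24Deep.frobeniusClassPrimes_mono _ _ hker₁ Sset τ hdvd₂₁ hq
  have hτμ₁ : τ ∈ rootsOfUnityFixer ℚ 3 := rootsOfUnityFixer_le_of_dvd ℚ hdvd₂₁ hτμ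
  -- the invariant `m₁` with `[3^{j+1}] m₁ ≠ 0`
  obtain ⟨m₁, hm₁, hred⟩ := exists_invariant_torsionMulBy_ne_zero W j q
    (natCard_invariants_toLocal_of_mem_frobeniusClassPrimes _ hq hτ₂)
    (natCard_invariants_toLocal_of_mem_frobeniusClassPrimes _ hq₃ hτ₃)
  -- `(ℓ − 1)·E[3^{j+1}·3] = 0`, `E[3]` unramified at `q`, `χ̄_ℓ` onto on inertia, `#𝒯(ℚ_q, E[3]) = 3`
  have hM₂ : ∀ m : geomTorsion W (((3 : ℕ) : ℤ) ^ (j + 1) * ((3 : ℕ) : ℤ)), 3 ^ (j + 1 + 1) • m = 0 :=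
    pow_succ_nsmul_geomTorsion_eq_zero W 3 (j + 1)
  have hM₁ : ∀ m : geomTorsion W ((3 : ℕ) : ℤ), 3 • m = 0 := three_nsmul_geomTorsion_three W
  have hM₂' : ∀ m : geomTorsion W (((3 : ℕ) : ℤ) ^ (j + 1) * ((3 : ℕ) : ℤ)),
      (Ideal.absNorm q.asIdeal - 1) • m = 0 :=
    absNorm_sub_one_smul_eq_zero_of_mem_frobeniusClassPrimes _ hq hτμ hM₂
  have hM₁' : ∀ m : geomTorsion W ((3 : ℕ) : ℤ), (Ideal.absNorm q.asIdeal - 1) • m = 0 :=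
    absNorm_sub_one_smul_eq_zero_of_mem_frobeniusClassPrimes _ hq₁ hτμ₁ hM₁
  have hI₂ : ∀ t ∈ absInertia (q.adicCompletion ℚ), ∀ m : geomTorsion W ((3 : ℕ) : ℤ),
      GaloisRep.toLocal q (W.torsionGaloisModule ((3 : ℕ) : ℤ)) t m = m := by
    intro t ht m
    have h := (GaloisRep.isUnramifiedAt_iff_toLocal_holds q (W.torsionGaloisModule ((3 : ℕ) : ℤ))).1
      hq₁.2.2.1 t ht
    rw [h]
    rfl
  have hT₃ := natCard_cyclotomicTransverse_rat_of_mem_frobeniusClassPrimes' _ hq₁ hτ₁ hM₁'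
  exact cyclotomicTransverse_le_map_localMap_of_invariant
    (W.torsionGaloisModule (((3 : ℕ) : ℤ) ^ (j + 1) * ((3 : ℕ) : ℤ))) (W.torsionGaloisModule ((3 : ℕ) : ℤ)) q
    (W.torsionMulBy (((3 : ℕ) : ℤ) ^ (j + 1)) ((3 : ℕ) : ℤ)) m₁ hm₁ hred hM₂' hI₂
    (modPCyclotomicCharacter_surjOn_absInertia_rat_holds q) Nat.prime_three hT₃

end Curve

end Summit.BirchSwinnertonDyer.BirchSwinnertonDyer.Theorems.KimAtThreeShallowEqDeepGoodCoreVertex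

end
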